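import Literature.Probability.LatticeModels.FKExplorationDomainMarkov
import Literature.Probability.Percolation.FiniteEnergy
import Mathlib.MeasureTheory.Measure.Real
import HarnessLib

/-!
# Strong Markov property of the bond-ℤ² medial exploration, product form

Topic: `Summits/CriticalPhenomena/CardyFormulaZ2`. For the crux `LagHandOff` (line
hitting-tournament): the exploration prefix event `C_n(ω₀) = explorationCylinder hE ω₀ n` is a
bond cylinder over the *free* explored edges `e_i(ω₀)`, `i < min n N(ω₀)`
(`mem_explorationCylinder_iff_free`), so under Bernoulli(1/2) bond percolation on `ℤ²` it is
independent of every measurable event `F` determined by a set of edges `S` missing those free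
explored edges: `P(C_n(ω₀) ∩ F) = P(C_n(ω₀)) · P(F)` (`bondPercolation_real_inter_of_disjoint`).
-/

noncomputable section

open MeasureTheory Filter Set Topology
open Literature.Probability.Percolation Literature.Probability.LatticeModels

namespace Summit.CriticalPhenomena.CardyFormulaZ2.Cruxes.LagHandOff.HittingTournament

/-- The exploration prefix event `C_n(ω₀)` is determined by the set of *free* explored edges
`e_i(ω₀)`, `i < min n N(ω₀)`. -/
theorem determinedBy_explorationCylinder_freeExplored (E : DiscreteDobrushin)
    (hE : E.IsZdAdmissible) (ω₀ : BondConfig (Site 2)) (n : ℕ) :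
    DeterminedBy (DiscreteDobrushin.explorationCylinder hE ω₀ n)
      {e | ∃ i < min n (DiscreteDobrushin.exitTime hE ω₀),
        E.IsFreeEdge (DiscreteDobrushin.exploredEdge hE ω₀ i) ∧
          e = DiscreteDobrushin.exploredEdge hE ω₀ i} := by
  rw [determinedBy_iff]
  intro ω ω' hωω'
  rw [DiscreteDobrushin.mem_explorationCylinder_iff_free,
    DiscreteDobrushin.mem_explorationCylinder_iff_free]
  refine forall₂_congr fun i hi => forall_congr' fun hf => ?_
  have he : DiscreteDobrushin.exploredEdge hE ω₀ i ∈
      {e | ∃ i < min n (DiscreteDobrushin.exitTime hE ω₀),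
        E.IsFreeEdge (DiscreteDobrushin.exploredEdge hE ω₀ i) ∧
          e = DiscreteDobrushin.exploredEdge hE ω₀ i} := ⟨i, hi, hf, rfl⟩
  have key : DiscreteDobrushin.exploredEdge hE ω₀ i ∈ ω ↔
      DiscreteDobrushin.exploredEdge hE ω₀ i ∈ ω' :=
    ⟨fun h => ((Set.ext_iff.1 hωω' _).1 ⟨h, he⟩).1,
      fun h => ((Set.ext_iff.1 hωω' _).2 ⟨h, he⟩).1⟩
  rw [key]

/-- **Strong Markov property of the medial exploration, product form.** Under Bernoulli(1/2)
bond percolation on `ℤ²`, the exploration prefix event `C_n(ω₀)` is independent of every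
measurable event `F` determined by a set of edges `S` avoiding the free explored edges
`e_i(ω₀)`, `i < min n N(ω₀)`: `P(C_n(ω₀) ∩ F) = P(C_n(ω₀)) · P(F)`. -/
theorem stub_kernel_explorationCylinder_indep :
    ∀ (E : DiscreteDobrushin) (hE : E.IsZdAdmissible) (ω₀ : BondConfig (Site 2)) (n : ℕ)
      (F : Set (BondConfig (Site 2))) (S : Set (Sym2 (Site 2))),
      DeterminedBy F S → MeasurableSet F →
      (∀ i < min n (DiscreteDobrushin.exitTime hE ω₀),
          E.IsFreeEdge (DiscreteDobrushin.exploredEdge hE ω₀ i) →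
            DiscreteDobrushin.exploredEdge hE ω₀ i ∉ S) →
      (bondPercolation (zdGraph 2) half).real (DiscreteDobrushin.explorationCylinder hE ω₀ n ∩ F) =
        (bondPercolation (zdGraph 2) half).real (DiscreteDobrushin.explorationCylinder hE ω₀ n) *
          (bondPercolation (zdGraph 2) half).real F := by
  intro E hE ω₀ n F S hF hFm hS
  have hT := determinedBy_explorationCylinder_freeExplored E hE ω₀ n
  have hF' : DeterminedBy F
      {e | ∃ i < min n (DiscreteDobrushin.exitTime hE ω₀),
        E.IsFreeEdge (DiscreteDobrushin.exploredEdge hE ω₀ i) ∧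
          e = DiscreteDobrushin.exploredEdge hE ω₀ i}ᶜ := by
    refine hF.mono fun e heS heT => ?_
    obtain ⟨i, hi, hf, rfl⟩ := heT
    exact hS i hi hf heS
  exact bondPercolation_real_inter_of_disjoint (zdGraph 2) half disjoint_compl_right hT hF'
    (DiscreteDobrushin.measurableSet_explorationCylinder ω₀ n) hFm

end Summit.CriticalPhenomena.CardyFormulaZ2.Cruxes.LagHandOff.HittingTournament

end
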